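import Literature.Topology.FourManifolds.BandSumUnitLoops
import Literature.Topology.FourManifolds.ConnectedSumNormalForm
import HarnessLib

/-!
# The unknot is a unit for the connected sum, V: the splitting sphere

Topic `Literature/Topology/FourManifolds`; fifth file of the discharge of
`Literature.Topology.FourManifolds.Knot.exists_isConnectedSum_unknot_isIsotopic` (`BandSum.lean`;
Rolfsen (1976), §2.G). The connected sum `K # O` needs a smoothly embedded 2-sphere splitting the
flat-arc knot `K = C.K` from the small unknot `O = C.oKnot 1` and crossing the band in its middle
segment. Since the whole knot lies at height `≥ p₂` in the chart (`FlatArcConfig.height`) and `O` at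
depth `≥ λ` below the arc, the **horizontal plane at depth `λ/2`** separates them; completed by the
south pole it is a round 2-sphere of `𝕊³`, which we realise as an embedding as follows:

* `BandSumUnit.sphereRot` — the standard equatorial 2-sphere (`SphereEmbedding.standard 2 3`, needs
  `[SphereEmbedding.SmoothnessFacts]`) turned by the quarter rotation `rotLastTwoDiffeo (π/2)` of
  `𝕊³` so as to pass through the south pole: its range is `{y | y₂ = 0}`, whose chart image is the
  plane `⟪z, frame 2⟫ = 0` (`coe_psi_symm_apply_two_eq_zero_iff`);
* `FlatArcConfig.sEquiv`, `sCenter` — the affine map `z ↦ c_S + sEquiv z` of positive determinant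
  carrying that plane onto the horizontal plane at height `p₂ - λ/2` (frame map with targets
  `e, w₀, ∓e₂`); `FlatArcConfig.sIso` — the affine ambient isotopy of `ℝ³` realising it on the large
  ball `‖z‖ ≤ rS` (`AffineIsotopy.exists_ambientIsotopy_affine`), `sAmb` its transport along `ψ`,
  and **`FlatArcConfig.sphereS := sphereRot.map (sAmb 1)`**;
* `FlatArcConfig.psi_symm_mem_range_sphereS_iff` — within the chart ball of radius `4 (ρ + λ)`
  (containing the knot, the unknot and the band) a point lies on `sphereS` iff its height is
  `p₂ - λ/2`; `FlatArcConfig.exists_sides` — the two complementary components, told apart by the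
  sign of `height - (p₂ - λ/2)`;
* `FlatArcConfig.isSplitBy_sphereS : Knot.IsSplitBy sphereS C.K (C.oKnot 1)` — disjointness by
  heights, and every path from `K` to `O` meets `sphereS` (a preconnected set inside the union of the
  two open sides lies in one of them);
* `FlatArcConfig.toSphere_mem_range_sphereS_iff` — a plane point of the band region lies on `sphereS`
  iff its depth is `λ/2` (the crossing condition of `Knot.IsConnectedSum`).

## References

* D. Rolfsen, *Knots and Links* (1976), §2.G, §4.B. [Rolfsen1976]
* M. W. Hirsch, *Differential Topology* (1976), Ch. 8 §3, Thm. 3.1 (proof). [HirschDT1976]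

## Design notes

All statements are `[folklore]`; no named facts, no `sorry`.
-/

open scoped Manifold ContDiff Topology RealInnerProductSpace Real
open Function Set Metric Module Real

noncomputable section

namespace Literature.Topology.FourManifolds

/-- Local notation: `𝔼 n` is the model Euclidean space `EuclideanSpace ℝ (Fin n)`. -/
local notation "𝔼 " n:arg => EuclideanSpace ℝ (Fin n)

/-- Local notation: `𝕊 n` is the unit sphere in `EuclideanSpace ℝ (Fin (n + 1))`. -/
local notation "𝕊 " n:arg => (Metric.sphere (0 : EuclideanSpace ℝ (Fin (n + 1))) 1)

attribute [local instance] fact_finrank_euclideanSpace_succ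

namespace BandSumUnit

open KnotsInBall

/-! ### The standard sphere through the south pole -/

section Rot

variable [SphereEmbedding.SmoothnessFacts]

/-- **The 2-sphere `{y₂ = 0}` of `𝕊³`**: the standard equatorial sphere `{x₃ = 0}` turned by the
quarter rotation in the last two coordinates; it passes through both poles. [folklore] -/
def sphereRot : SphereEmbedding 2 3 :=
  (SphereEmbedding.standard 2 3 (by norm_num)).map (rotLastTwoDiffeo (π / 2))

/-- **The range of the turned sphere is `{y | y₂ = 0}`.** [folklore] -/
theorem mem_range_sphereRot_iff (y : 𝕊 3) : y ∈ range sphereRot ↔ (y : 𝔼 4) 2 = 0 := by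
  rw [sphereRot, SphereEmbedding.range_map, SphereEmbedding.range_standard_eq_sphereEquator]
  constructor
  · rintro ⟨x, hx, rfl⟩
    rw [mem_sphereEquator_iff] at hx
    change rotLastTwoAux (π / 2, (x : 𝔼 4)) 2 = 0
    rw [rotLastTwoAux_apply_two, Real.cos_pi_div_two, Real.sin_pi_div_two]
    have : (x : 𝔼 4) 3 = 0 := hx
    simp [this]
  · intro hy
    refine ⟨(rotLastTwoDiffeo (π / 2)).symm y, ?_, (rotLastTwoDiffeo (π / 2)).apply_symm_apply y⟩
    rw [mem_sphereEquator_iff]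
    change rotLastTwoAux (-(π / 2), (y : 𝔼 4)) 3 = 0
    have : rotLastTwoAux (-(π / 2), (y : 𝔼 4)) (Fin.last 3) =
        Real.sin (-(π / 2)) * (y : 𝔼 4) 2 + Real.cos (-(π / 2)) * (y : 𝔼 4) 3 := rfl
    rw [show (3 : Fin 4) = Fin.last 3 from rfl, this, Real.sin_neg, Real.cos_neg, Real.sin_pi_div_two,
      Real.cos_pi_div_two, hy]
    ring

end Rot

namespace FlatArcConfig

variable (C : FlatArcConfig)

/-! ### The placement of the plane -/

/-- The triple `(e, w₀, e₂)` (horizontal, horizontal, vertical). [folklore] -/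
def striple : Fin 3 → 𝔼 3 := ![C.e, C.wvec, vert]

/-- The triple `(e, w₀, e₂)` is orthonormal. [folklore] -/
theorem orthonormal_striple : Orthonormal ℝ C.striple := by
  rw [orthonormal_iff_ite]
  intro i j
  fin_cases i <;> fin_cases j <;>
    simp [striple, C.norm_e, C.inner_e_vert, C.inner_vert_e, C.inner_e_wvec, C.inner_wvec_e,
      C.inner_vert_wvec, C.inner_wvec_vert, norm_vert]

/-- The signs `(1, 1, -det F)`. [folklore] -/
def sSign : Fin 3 → ℝ := ![1, 1, -frameMat.det]

/-- `sSign i * sSign i = 1`. [folklore] -/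
theorem sSign_mul_self (i : Fin 3) : sSign i * sSign i = 1 := by
  fin_cases i
  · simp [sSign]
  · simp [sSign]
  · simp [sSign, det_frameMat_mul_self]

/-- **The targets** of the plane placement: `frame 0 ↦ e`, `frame 1 ↦ w₀`, `frame 2 ↦ -det F • e₂`.
[folklore] -/
def sTargets : Fin 3 → 𝔼 3 := fun i ↦ sSign i • C.striple i

/-- `sTargets 2 = -det F • vert`. [folklore] -/
theorem sTargets_two : C.sTargets 2 = (-frameMat.det) • vert := rfl

/-- Heights of the targets: `(sTargets i)₂ = -det F` for `i = 2` and `0` otherwise. [folklore] -/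
theorem sTargets_apply_two (i : Fin 3) : C.sTargets i 2 = if i = 2 then -frameMat.det else 0 := by
  fin_cases i <;> simp [sTargets, sSign, striple, C.e_two, vert_apply]

/-- Inner products of the targets. [folklore] -/
theorem inner_sTargets (i j : Fin 3) : ⟪C.sTargets i, C.sTargets j⟫ = if i = j then (1 : ℝ) else 0 := by
  simp only [sTargets, inner_smul_left, inner_smul_right, orthonormal_iff_ite.1 C.orthonormal_striple]
  by_cases h : i = j
  · subst h; simp only [if_true, conj_trivial, mul_one]; exact sSign_mul_self i
  · simp [h]

/-- The targets are orthonormal. [folklore] -/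
theorem orthonormal_sTargets : Orthonormal ℝ C.sTargets :=
  orthonormal_iff_ite.2 C.inner_sTargets

/-- **The determinant of the plane placement is `1`.** [folklore] -/
theorem det_toMat_frameMap_sTargets : (AffineIsotopy.toMat (frameMap C.sTargets)).det = 1 := by
  rw [toMat_frameMap, Matrix.det_mul]
  have hT : (colMat C.sTargets).det = frameMat.det := by
    rw [Matrix.det_fin_three]
    simp only [colMat, Matrix.of_apply, sTargets, sSign, striple, PiLp.smul_apply, smul_eq_mul,
      vert_apply, wvec_apply_zero, wvec_apply_one, wvec_apply_two, C.e_two, Matrix.cons_val_zero,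
      Matrix.cons_val_one, Matrix.cons_val_two, Matrix.head_cons, Matrix.tail_cons]
    simp only [Fin.isValue, Fin.reduceEq, ↓reduceIte]
    have := C.e_sq_add
    linear_combination frameMat.det * this
  rw [hT, det_frameMat_mul_self]

/-- The inverse of the plane placement. [folklore] -/
def sInverse : 𝔼 3 →L[ℝ] 𝔼 3 := ∑ i, (innerSL ℝ (C.sTargets i)).smulRight (frame i)

/-- The inverse applied. [folklore] -/
theorem sInverse_apply (y : 𝔼 3) : C.sInverse y = ∑ i, ⟪C.sTargets i, y⟫ • frame i := by
  simp [sInverse, ContinuousLinearMap.smulRight_apply]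

/-- `sInverse ∘ frameMap sTargets = id`. [folklore] -/
theorem sInverse_frameMap (z : 𝔼 3) : C.sInverse (frameMap C.sTargets z) = z := by
  rw [frameMap_apply, sInverse_apply]
  have key : ∀ i, ⟪C.sTargets i, ∑ j, ⟪frame j, z⟫ • C.sTargets j⟫ = ⟪frame i, z⟫ := by
    intro i
    rw [inner_sum, Finset.sum_eq_single i]
    · rw [inner_smul_right, inner_sTargets, if_pos rfl, mul_one]
    · intro j _ hji; rw [inner_smul_right, inner_sTargets, if_neg (Ne.symm hji), mul_zero]
    · simp
  simp_rw [key]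
  exact sum_inner_smul_of_orthonormal' orthonormal_frame z

/-- `frameMap sTargets ∘ sInverse = id`. [folklore] -/
theorem frameMap_sInverse (y : 𝔼 3) : frameMap C.sTargets (C.sInverse y) = y := by
  rw [sInverse_apply, map_sum]
  simp_rw [map_smul, frameMap_frame]
  exact sum_inner_smul_of_orthonormal' C.orthonormal_sTargets y

/-- A crude bound for the inverse: `‖sInverse y‖ ≤ 3 ‖y‖`. [folklore] -/
theorem norm_sInverse_le (y : 𝔼 3) : ‖C.sInverse y‖ ≤ 3 * ‖y‖ := by
  rw [sInverse_apply]
  have hn : ∀ i, ‖C.sTargets i‖ = 1 := C.orthonormal_sTargets.1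
  calc ‖∑ i, ⟪C.sTargets i, y⟫ • frame i‖ ≤ ∑ i, ‖⟪C.sTargets i, y⟫ • frame i‖ := norm_sum_le _ _
    _ ≤ ∑ _i : Fin 3, ‖y‖ := Finset.sum_le_sum fun i _ ↦ by
        rw [norm_smul, norm_frame, mul_one]
        have := abs_real_inner_le_norm (C.sTargets i) y
        rw [hn i, one_mul] at this
        exact this
    _ = 3 * ‖y‖ := by simp

/-- **The plane placement automorphism** `sEquiv : ℝ³ ≃ ℝ³`, `frame i ↦ sTargets i`. [folklore] -/
def sEquiv : 𝔼 3 ≃L[ℝ] 𝔼 3 :=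
  ContinuousLinearEquiv.equivOfInverse (frameMap C.sTargets) C.sInverse C.sInverse_frameMap
    C.frameMap_sInverse

/-- `sEquiv` as a map. [folklore] -/
@[simp] theorem coe_sEquiv : (C.sEquiv : 𝔼 3 →L[ℝ] 𝔼 3) = frameMap C.sTargets := rfl

/-- `sEquiv z = frameMap sTargets z`. [folklore] -/
theorem sEquiv_apply (z : 𝔼 3) : C.sEquiv z = frameMap C.sTargets z := rfl

/-- `sEquiv⁻¹ = sInverse`. [folklore] -/
theorem sEquiv_symm_apply (y : 𝔼 3) : C.sEquiv.symm y = C.sInverse y := rfl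

/-- **The height of `sEquiv z` is `-det F · ⟪z, frame 2⟫`.** [folklore] -/
theorem sEquiv_apply_two (z : 𝔼 3) : C.sEquiv z 2 = -frameMat.det * ⟪z, frame 2⟫ := by
  rw [sEquiv_apply, frameMap_apply]
  rw [show (∑ i, ⟪frame i, z⟫ • C.sTargets i) 2 = ∑ i, (⟪frame i, z⟫ • C.sTargets i) 2 from by simp]
  simp only [PiLp.smul_apply, smul_eq_mul, sTargets_apply_two, mul_ite, mul_zero,
    Finset.sum_ite_eq', Finset.mem_univ, if_true]
  rw [real_inner_comm]; ring

/-- The centre of the placement: the point at depth `λ/2` below the base point. [folklore] -/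
def sCenter : 𝔼 3 := C.planeMap (pt2 0 (C.lam / 2))

/-- Height of the centre. [folklore] -/
@[simp] theorem sCenter_apply_two : C.sCenter 2 = C.p 2 - C.lam / 2 := by
  rw [sCenter, planeMap_apply_two]; rfl

/-- **The placement** `T_S z = c_S + sEquiv z`. [folklore] -/
def sPlace (z : 𝔼 3) : 𝔼 3 := C.sCenter + C.sEquiv z

/-- Height of a placed point. [folklore] -/
theorem sPlace_apply_two (z : 𝔼 3) : C.sPlace z 2 = C.p 2 - C.lam / 2 - frameMat.det * ⟪z, frame 2⟫ := by
  rw [sPlace, PiLp.add_apply, sCenter_apply_two, sEquiv_apply_two]; ring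

/-- The placement is inverted by `z = sEquiv⁻¹ (q - c_S)`. [folklore] -/
theorem sPlace_symm (q : 𝔼 3) : C.sPlace (C.sEquiv.symm (q - C.sCenter)) = q := by
  rw [sPlace, ContinuousLinearEquiv.apply_symm_apply, add_sub_cancel]

/-- `⟪z, frame 2⟫` in terms of the height of the placed point. [folklore] -/
theorem inner_frame_two_eq (z : 𝔼 3) :
    ⟪z, frame 2⟫ = -frameMat.det * (C.sPlace z 2 - (C.p 2 - C.lam / 2)) := by
  rw [sPlace_apply_two]
  have := det_frameMat_mul_self
  linear_combination (-⟪z, frame 2⟫) * this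

/-! ### The radius -/

/-- A bound `ρ` for the chart image of the knot. [folklore] -/
def ρK : ℝ := C.exists_norm_chartPt_le.choose

/-- `0 < ρ`. [folklore] -/
theorem ρK_pos : 0 < C.ρK := C.exists_norm_chartPt_le.choose_spec.1

/-- `‖ψ (K x)‖ ≤ ρ`. [folklore] -/
theorem norm_chartPt_le (x : 𝕊 1) : ‖C.chartPt x‖ ≤ C.ρK := C.exists_norm_chartPt_le.choose_spec.2 x

/-- `‖p‖ ≤ ρ` (the base point is the knot point of tangent coordinate `0`). [folklore] -/
theorem norm_p_le : ‖C.p‖ ≤ C.ρK := by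
  have h0 : (0 : ℝ) ∈ Icc (-C.ℓ) C.ℓ := ⟨by linarith [C.ℓ_pos], C.ℓ_pos.le⟩
  have h := C.norm_chartPt_le (circlePoint (C.θOf 0))
  rw [← chartCurve_eq_chartPt, C.chartCurve_eq_planeMap (C.θOf_mem h0), C.σ_θOf h0, planeMap_pt2,
    zero_smul, zero_smul, add_zero, sub_zero] at h
  exact h

/-- **The working radius** of the chart: `4 (ρ + λ)`; the knot, the unknot and the band lie in the
ball of this radius. [folklore] -/
def rW : ℝ := 4 * (C.ρK + C.lam)

/-- The radius of the ball on which the affine isotopy is prescribed: `30 (ρ + λ)`. [folklore] -/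
def rS : ℝ := 30 * (C.ρK + C.lam)

/-- Plane points with small coordinates lie in the working ball. [folklore] -/
theorem norm_planeMap_le {q : 𝔼 2} (h0 : |q 0| ≤ 3 * C.lam / 2) (h1 : |q 1| ≤ 5 * C.lam / 2) :
    ‖C.planeMap q‖ ≤ C.rW := by
  rw [planeMap_apply]
  have := C.norm_p_le; have := C.ρK_pos; have := C.lam_pos
  calc ‖C.p + q 0 • C.e - q 1 • vert‖ ≤ ‖C.p + q 0 • C.e‖ + ‖q 1 • vert‖ := norm_sub_le _ _
    _ ≤ ‖C.p‖ + ‖q 0 • C.e‖ + ‖q 1 • vert‖ := by gcongr; exact norm_add_le _ _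
    _ = ‖C.p‖ + |q 0| + |q 1| := by rw [norm_smul, norm_smul, C.norm_e, norm_vert]; simp
    _ ≤ C.rW := by unfold rW; linarith

/-- Points of the working ball are placements of points of the big ball. [folklore] -/
theorem norm_symm_le_rS {q : 𝔼 3} (hq : ‖q‖ ≤ C.rW) : ‖C.sEquiv.symm (q - C.sCenter)‖ ≤ C.rS := by
  rw [sEquiv_symm_apply]
  have h1 := C.norm_sInverse_le (q - C.sCenter)
  have h2 : ‖q - C.sCenter‖ ≤ ‖q‖ + ‖C.sCenter‖ := norm_sub_le _ _
  have h3 : ‖C.sCenter‖ ≤ C.rW := C.norm_planeMap_le (by simp; linarith [C.lam_pos])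
    (by rw [pt2_apply_one, abs_of_pos (by linarith [C.lam_pos])]; linarith [C.lam_pos])
  unfold rS; unfold rW at hq h3
  linarith [C.ρK_pos, C.lam_pos]

/-! ### The affine isotopy and the sphere -/

/-- The determinant condition of the placement. [folklore] -/
theorem det_cond : 0 < (AffineIsotopy.toMat ((ContinuousLinearEquiv.refl ℝ (𝔼 3) : 𝔼 3 ≃L[ℝ] 𝔼 3) :
    𝔼 3 →L[ℝ] 𝔼 3)).det * (AffineIsotopy.toMat (C.sEquiv : 𝔼 3 →L[ℝ] 𝔼 3)).det := by
  rw [ContinuousLinearEquiv.coe_refl, AffineIsotopy.toMat_id, Matrix.det_one, one_mul, coe_sEquiv,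
    det_toMat_frameMap_sTargets]
  exact one_pos

/-- **The affine ambient isotopy of `ℝ³`** from the identity to the placement `T_S` on the big ball
(`AffineIsotopy.exists_ambientIsotopy_affine`, chosen). [folklore] -/
def sIso : AmbientIsotopy 𝓘(ℝ, 𝔼 3) (𝔼 3) :=
  (AffineIsotopy.exists_ambientIsotopy_affine (q₀ := 0) (q₁ := C.sCenter) (c := 0)
    (L₀ := ContinuousLinearEquiv.refl ℝ (𝔼 3)) (L₁ := C.sEquiv) C.det_cond C.rS).choose

/-- The end stage of `sIso` is the placement on the big ball. [folklore] -/
theorem sIso_one {z : 𝔼 3} (hz : ‖z‖ ≤ C.rS) : C.sIso.toFun 1 z = C.sPlace z := by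
  have h := (AffineIsotopy.exists_ambientIsotopy_affine (q₀ := 0) (q₁ := C.sCenter) (c := 0)
    (L₀ := ContinuousLinearEquiv.refl ℝ (𝔼 3)) (L₁ := C.sEquiv) C.det_cond C.rS).choose_spec.1 z
    (by rwa [mem_closedBall, dist_zero_right])
  unfold sIso sPlace
  simpa using h

/-- A support radius of `sIso`. [folklore] -/
def sR : ℝ :=
  (AffineIsotopy.exists_ambientIsotopy_affine (q₀ := 0) (q₁ := C.sCenter) (c := 0)
    (L₀ := ContinuousLinearEquiv.refl ℝ (𝔼 3)) (L₁ := C.sEquiv) C.det_cond C.rS).choose_spec.2.choose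

/-- `sIso` is the identity off the ball of radius `sR`. [folklore] -/
theorem sIso_eq_self : ∀ t (y : 𝔼 3), C.sR ≤ ‖y‖ → C.sIso.toFun t y = y :=
  (AffineIsotopy.exists_ambientIsotopy_affine (q₀ := 0) (q₁ := C.sCenter) (c := 0)
    (L₀ := ContinuousLinearEquiv.refl ℝ (𝔼 3)) (L₁ := C.sEquiv) C.det_cond C.rS).choose_spec.2.choose_spec

/-- **The transported ambient isotopy of `𝕊³`.** [folklore] -/
def sAmb : AmbientIsotopy (𝓡 3) (𝕊 3) :=
  C.sIso.alongChart (φ := psi) contMDiffOn_psi contMDiff_psi_symm psi_target C.sIso_eq_self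

/-- The transported isotopy through the chart. [folklore] -/
theorem sAmb_apply {t : ℝ} {y : 𝕊 3} (hy : y ≠ southPole) :
    C.sAmb.toFun t y = psi.symm (C.sIso.toFun t (psi y)) := by
  rw [sAmb, AmbientIsotopy.alongChart_toFun, chartTransport_of_mem _ (mem_psi_source hy)]

/-- The transported isotopy fixes the south pole. [folklore] -/
theorem sAmb_southPole (t : ℝ) : C.sAmb.toFun t southPole = southPole := by
  rw [sAmb, AmbientIsotopy.alongChart_toFun]
  exact chartTransport_of_not_mem _ (by rw [psi_source]; exact fun h ↦ h rfl)

/-! ### Sizes of the knot and of the small unknot -/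

/-- The knot lies in the working ball, strictly above the plane. [folklore] -/
theorem knot_side (x : 𝕊 1) : ‖C.chartPt x‖ ≤ C.rW ∧ C.p 2 - C.lam / 2 < C.chartPt x 2 := by
  have h : C.p 2 ≤ C.chartPt x 2 := C.height x
  refine ⟨(C.norm_chartPt_le x).trans ?_, by linarith [C.lam_pos]⟩
  unfold rW; linarith [C.ρK_pos, C.lam_pos]

/-- Points of the D-loop stages have bounded planar coordinates. [folklore] -/
theorem abs_dloop_le {τ : ℝ} (hτ : τ ∈ Icc (0 : ℝ) 1) (θ : ℝ) :
    |dloop C.lam τ θ 0| ≤ 3 * C.lam / 2 ∧ |dloop C.lam τ θ 1| ≤ 5 * C.lam / 2 := by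
  have hL := C.lam_pos
  constructor
  · rw [dloop_apply_zero, abs_mul, abs_of_pos hL]
    nlinarith [abs_cos_le_one θ]
  · rw [dloop_apply_one, spFam]
    set x := C.lam / 2 - C.lam * Real.sin θ with hx
    have h1 : -(C.lam / 2) ≤ x := by rw [hx]; nlinarith [Real.sin_le_one θ]
    have h2 : x ≤ 3 * C.lam / 2 := by rw [hx]; nlinarith [Real.neg_one_le_sin θ]
    have hsp0 := sp_nonneg (by positivity : 0 < C.lam / 8) x
    have hsp1 : sp (C.lam / 8) x ≤ 3 * C.lam / 2 := by
      rcases le_or_gt x 0 with h | h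
      · rw [sp_of_nonpos (by positivity) h]; linarith
      · exact (sp_le_self _ h.le).trans h2
    have p1 := mul_nonneg (sub_nonneg.2 hτ.2) (by linarith : 0 ≤ x + C.lam / 2)
    have p2 := mul_nonneg (sub_nonneg.2 hτ.2) (by linarith : 0 ≤ 3 * C.lam / 2 - x)
    have p3 := mul_nonneg hτ.1 hsp0
    have p4 := mul_nonneg hτ.1 (by linarith : 0 ≤ 3 * C.lam / 2 - sp (C.lam / 8) x)
    rw [abs_le]
    constructor <;> nlinarith

/-- The small unknot lies in the working ball, strictly below the plane. [folklore] -/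
theorem oKnot_side (θ : ℝ) : ‖C.planeMap (dloop C.lam 1 θ)‖ ≤ C.rW ∧
    C.planeMap (dloop C.lam 1 θ) 2 < C.p 2 - C.lam / 2 := by
  have h := C.abs_dloop_le ⟨zero_le_one, le_rfl⟩ θ
  refine ⟨C.norm_planeMap_le h.1 h.2, ?_⟩
  rw [planeMap_apply_two]
  have := le_dloop_one_apply_one C.lam_pos θ
  linarith [C.lam_pos]

section Sphere

variable [SphereEmbedding.SmoothnessFacts]

/-- **The splitting sphere** `S`: the turned standard sphere moved by the end stage of `sAmb`; in the
working ball of the chart it is the horizontal plane at height `p₂ - λ/2`. [folklore] -/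
def sphereS : SphereEmbedding 2 3 := sphereRot.map (C.sAmb.toDiffeomorph 1)

/-- The range of `S`. [folklore] -/
theorem range_sphereS : range C.sphereS = C.sAmb.toFun 1 '' {y : 𝕊 3 | (y : 𝔼 4) 2 = 0} := by
  rw [sphereS, SphereEmbedding.range_map]
  congr 1
  ext y; exact mem_range_sphereRot_iff y

/-- **The sphere in the working ball is the horizontal plane at height `p₂ - λ/2`.** [folklore] -/
theorem psi_symm_mem_range_sphereS_iff {q : 𝔼 3} (hq : ‖q‖ ≤ C.rW) :
    psi.symm q ∈ range C.sphereS ↔ q 2 = C.p 2 - C.lam / 2 := by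
  rw [range_sphereS]
  set z := C.sEquiv.symm (q - C.sCenter) with hz
  have hzr : ‖z‖ ≤ C.rS := C.norm_symm_le_rS hq
  have hq' : C.sPlace z = q := C.sPlace_symm q
  constructor
  · rintro ⟨y, hy, hyq⟩
    have hys : y ≠ southPole := by
      rintro rfl
      rw [C.sAmb_southPole] at hyq
      exact psi_symm_ne_southPole q hyq.symm
    rw [C.sAmb_apply hys] at hyq
    have h1 : C.sIso.toFun 1 (psi y) = q := by
      have := congrArg psi hyq; rwa [psi_apply_psi_symm, psi_apply_psi_symm] at this
    -- `psi y = z` by injectivity of the stage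
    have h2 : psi y = z := by
      apply (C.sIso.bijective 1).1
      rw [h1, C.sIso_one hzr, hq']
    have h3 : ⟪z, frame 2⟫ = 0 := by
      rw [← h2, ← coe_psi_symm_apply_two_eq_zero_iff, psi_symm_apply_psi hys]; exact hy
    have h4 := C.inner_frame_two_eq z
    rw [h3, hq'] at h4
    have hd := det_frameMat_ne_zero
    have h5 : q 2 - (C.p 2 - C.lam / 2) = 0 := by
      have h6 : -frameMat.det * (q 2 - (C.p 2 - C.lam / 2)) = 0 := h4.symm
      rcases mul_eq_zero.1 h6 with h | h
      · exact absurd (neg_eq_zero.1 h) hd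
      · exact h
    linarith
  · intro h
    refine ⟨psi.symm z, ?_, ?_⟩
    · show ((psi.symm z : 𝕊 3) : 𝔼 4) 2 = 0
      rw [coe_psi_symm_apply_two_eq_zero_iff, C.inner_frame_two_eq z, hq', h]; ring
    · rw [C.sAmb_apply (psi_symm_ne_southPole z), psi_apply_psi_symm, C.sIso_one hzr, hq']

/-- **The two sides of `S`.** There are disjoint open sets `A`, `B` with `A ∪ B = (range S)ᶜ` such
that a point of the working ball strictly above the height `p₂ - λ/2` lies in `A`, strictly below it
in `B`. [folklore] -/
theorem exists_sides : ∃ A B : Set (𝕊 3), IsOpen A ∧ IsOpen B ∧ Disjoint A B ∧ A ∪ B = (range C.sphereS)ᶜ ∧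
    (∀ q : 𝔼 3, ‖q‖ ≤ C.rW → C.p 2 - C.lam / 2 < q 2 → psi.symm q ∈ A) ∧
    (∀ q : 𝔼 3, ‖q‖ ≤ C.rW → q 2 < C.p 2 - C.lam / 2 → psi.symm q ∈ B) := by
  set Φ := C.sAmb.toDiffeomorph 1 with hΦ
  set s : ℝ := -frameMat.det with hs
  have hs1 : s = 1 ∨ s = -1 := by
    rcases det_frameMat_eq with h | h
    · right; rw [hs, h]
    · left; rw [hs, h]; norm_num
  have hc2 : Continuous fun y : 𝕊 3 ↦ s * (y : 𝔼 4) 2 :=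
    continuous_const.mul ((PiLp.continuous_apply 2 _ 2).comp continuous_subtype_val)
  refine ⟨Φ '' {y : 𝕊 3 | 0 < s * (y : 𝔼 4) 2}, Φ '' {y : 𝕊 3 | s * (y : 𝔼 4) 2 < 0},
    Φ.toHomeomorph.isOpenMap _ (isOpen_lt continuous_const hc2),
    Φ.toHomeomorph.isOpenMap _ (isOpen_lt hc2 continuous_const), ?_, ?_, ?_, ?_⟩
  · rw [Set.disjoint_iff]
    rintro _ ⟨⟨y, hy, rfl⟩, ⟨y', hy', h⟩⟩
    have : y' = y := Φ.injective h
    subst this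
    simp only [mem_setOf_eq] at hy hy'
    exact absurd (lt_trans hy hy') (lt_irrefl _)
  · rw [range_sphereS, ← image_union]
    have hu : {y : 𝕊 3 | 0 < s * (y : 𝔼 4) 2} ∪ {y : 𝕊 3 | s * (y : 𝔼 4) 2 < 0} =
        {y : 𝕊 3 | (y : 𝔼 4) 2 = 0}ᶜ := by
      ext y
      simp only [mem_union, mem_setOf_eq, mem_compl_iff]
      constructor
      · rintro (h | h) h0 <;> rw [h0, mul_zero] at h <;> exact lt_irrefl _ h
      · intro h
        rcases hs1 with h1 | h1 <;> rw [h1]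
        · rcases lt_or_gt_of_ne h with h2 | h2
          · right; linarith
          · left; linarith
        · rcases lt_or_gt_of_ne h with h2 | h2
          · left; linarith
          · right; linarith
    rw [hu]
    change Φ '' {y : 𝕊 3 | (y : 𝔼 4) 2 = 0}ᶜ = (Φ '' {y : 𝕊 3 | (y : 𝔼 4) 2 = 0})ᶜ
    exact image_compl_eq Φ.bijective
  · intro q hq hgt
    set z := C.sEquiv.symm (q - C.sCenter)
    have hzr : ‖z‖ ≤ C.rS := C.norm_symm_le_rS hq
    have hq' : C.sPlace z = q := C.sPlace_symm q
    refine ⟨psi.symm z, ?_, ?_⟩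
    · show 0 < s * ((psi.symm z : 𝕊 3) : 𝔼 4) 2
      have hi : 0 < s * ⟪z, frame 2⟫ := by
        rw [C.inner_frame_two_eq z, hq', hs]
        have := det_frameMat_mul_self
        nlinarith
      rcases hs1 with h1 | h1
      · rw [h1, one_mul] at hi ⊢; exact (coe_psi_symm_apply_two_pos_iff z).2 hi
      · rw [h1, neg_one_mul] at hi ⊢
        exact neg_pos.2 ((coe_psi_symm_apply_two_neg_iff z).2 (neg_pos.1 hi))
    · change C.sAmb.toFun 1 (psi.symm z) = psi.symm q
      rw [C.sAmb_apply (psi_symm_ne_southPole z), psi_apply_psi_symm, C.sIso_one hzr, hq']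
  · intro q hq hlt
    set z := C.sEquiv.symm (q - C.sCenter)
    have hzr : ‖z‖ ≤ C.rS := C.norm_symm_le_rS hq
    have hq' : C.sPlace z = q := C.sPlace_symm q
    refine ⟨psi.symm z, ?_, ?_⟩
    · show s * ((psi.symm z : 𝕊 3) : 𝔼 4) 2 < 0
      have hi : s * ⟪z, frame 2⟫ < 0 := by
        rw [C.inner_frame_two_eq z, hq', hs]
        have := det_frameMat_mul_self
        nlinarith
      rcases hs1 with h1 | h1
      · rw [h1, one_mul] at hi ⊢; exact (coe_psi_symm_apply_two_neg_iff z).2 hi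
      · rw [h1, neg_one_mul] at hi ⊢
        exact neg_neg_iff_pos.2 ((coe_psi_symm_apply_two_pos_iff z).2 (neg_neg_iff_pos.1 hi))
    · change C.sAmb.toFun 1 (psi.symm z) = psi.symm q
      rw [C.sAmb_apply (psi_symm_ne_southPole z), psi_apply_psi_symm, C.sIso_one hzr, hq']

/-! ### The sphere splits the knot from the small unknot -/

/-- **`S` misses the knot.** [folklore] -/
theorem disjoint_sphereS_knot : Disjoint (range C.sphereS) (range C.K) := by
  rw [Set.disjoint_right]
  rintro _ ⟨x, rfl⟩ h
  rw [← C.psi_symm_chartPt x, C.psi_symm_mem_range_sphereS_iff (C.knot_side x).1] at h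
  linarith [(C.knot_side x).2]

/-- **`S` misses the small unknot.** [folklore] -/
theorem disjoint_sphereS_oKnot : Disjoint (range C.sphereS) (range (C.oKnot 1)) := by
  rw [Set.disjoint_right]
  intro y hy h
  obtain ⟨θ, rfl⟩ := (C.mem_range_oKnot_iff ⟨zero_le_one, le_rfl⟩).1 hy
  rw [toSphere_apply, C.psi_symm_mem_range_sphereS_iff (C.oKnot_side θ).1] at h
  linarith [(C.oKnot_side θ).2]

/-- **`S` splits the knot from the small unknot** (every path from the base point of `K` to the base
point of `O` meets `S`: a preconnected subset of the union of the two open sides lies in one side).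
[cite: Rolfsen1976, §4.B] -/
theorem isSplitBy_sphereS : Knot.IsSplitBy C.sphereS C.K (C.oKnot 1) := by
  refine ⟨?_, fun γ ↦ ?_⟩
  · rw [Set.disjoint_union_right]; exact ⟨C.disjoint_sphereS_knot, C.disjoint_sphereS_oKnot⟩
  · by_contra hne
    rw [Set.not_nonempty_iff_eq_empty] at hne
    obtain ⟨A, B, hA, hB, hAB, hU, hup, hdown⟩ := C.exists_sides
    have hsub : range γ ⊆ A ∪ B := by
      rw [hU]; intro y hy hyS; exact (Set.eq_empty_iff_forall_notMem.1 hne) y ⟨hy, hyS⟩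
    have h0 : γ 0 ∈ A := by
      rw [γ.source, ← C.psi_symm_chartPt]
      exact hup _ (C.knot_side _).1 (C.knot_side _).2
    have h1 : γ 1 ∈ B := by
      rw [γ.target, C.oKnot_circlePoint ⟨zero_le_one, le_rfl⟩, toSphere_apply]
      exact hdown _ (C.oKnot_side 0).1 (C.oKnot_side 0).2
    have hpre : IsPreconnected (range γ) := isPreconnected_range γ.continuous
    rcases hpre.subset_or_subset hA hB hAB hsub with h | h
    · exact Set.disjoint_left.1 hAB (h ⟨1, rfl⟩) h1
    · exact Set.disjoint_left.1 hAB.symm (h ⟨0, rfl⟩) h0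

/-- **The crossing condition**: a plane point with `|s| ≤ 3λ/2`, `|d| ≤ 5λ/2` lies on `S` iff its
depth is `λ/2`. [folklore] -/
theorem toSphere_mem_range_sphereS_iff {q : 𝔼 2} (h0 : |q 0| ≤ 3 * C.lam / 2) (h1 : |q 1| ≤ 5 * C.lam / 2) :
    C.toSphere q ∈ range C.sphereS ↔ q 1 = C.lam / 2 := by
  rw [toSphere_apply, C.psi_symm_mem_range_sphereS_iff (C.norm_planeMap_le h0 h1), planeMap_apply_two]
  constructor <;> intro h <;> linarith

end Sphere

end FlatArcConfig

end BandSumUnit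

end Literature.Topology.FourManifolds
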